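import Summits.BirchSwinnertonDyer.BirchSwinnertonDyer.Theorems.PrintX11aNonSurjEulerHalfOfMu
import Summits.BirchSwinnertonDyer.BirchSwinnertonDyer.Theorems.PrintX11aNonSurjMuAnHardDefs
import Summits.BirchSwinnertonDyer.BirchSwinnertonDyer.Theorems.PrintX11aUpperNonSurjThreeMultDivisibilityAtOfConjA
import Summits.BirchSwinnertonDyer.BirchSwinnertonDyer.Theorems.PrintX11aUpperNonSurjFiveMultTeichDefs
import Summits.BirchSwinnertonDyer.BirchSwinnertonDyer.Theorems.PrintX11aUpperNonSurjFiveOrbitUnitOfMultTeichSpan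
import Summits.BirchSwinnertonDyer.BirchSwinnertonDyer.Theorems.PrintX11aUpperNonSurjFiveMuAnOfOrbitUnit
import Summits.BirchSwinnertonDyer.BirchSwinnertonDyer.Theorems.PrintX11aUpperNonSurjFiveMuRoadGivesConjA
import Summits.BirchSwinnertonDyer.BirchSwinnertonDyer.Theorems.PrintX11aUpperNonSurjFiveOfCornerTwinMuAn
import Summits.BirchSwinnertonDyer.BirchSwinnertonDyer.Theorems.PrintX11aUpperNonSurjThreeOfNineFacts
import Summits.BirchSwinnertonDyer.Rank1Residual.GaloisImage.MultiplicativeLargeImage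
import Literature.NumberTheory.EllipticCurves.Rank1Residual.MuLambdaCarriers
import HarnessLib

/-!
# Line «finemu5» r7 (r4 = finemu5 ⊕ multteich5, v4 shape) for the child crux U5 = `PrintX11a.UpperNonSurjFive`
# (item stmt-BirchSwinnertonDyer-20614) of route `route-BirchSwinnertonDyer-PrintX11a` — lead bsd-line-x11a-p3 g2 (r3) / g3 (r4) / g4 (r5) / g6 (r6) / g7 (r7), 2026-08-28

BSD is not proved by any of this; nothing is asserted about any curve; the seven `sorry`s below are the registered stubs;
every composition (`UpperNonSurjFive_of`, `muAnHardFive_of_multTeich`, `UpperNonSurjFive_of_multTeich`, `UpperNonSurjFive_of_orbitUnit`,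
`UpperNonSurjFive_of_muAnHard`, `UpperNonSurjFive_of_muAnHard_nineFactsOddGS`, `X11aNonSurjEulerHalf_of_muAnHard_nineFactsOddGS`) is a real proof.

r7 (lead g7, 2026-08-28T11:3xZ): r5 UNCHANGED IN EVERY DECLARATION plus ONE print-exact fact stub and two compositions.  g6's r6 (registered
11:01Z, sha16 90d6e94546075a71; its file died with g6's folder before the crux-dir copy could be written — farm lag) had added
`FineMu.stub_nineFactsAn` = the nine print-exact facts of U3's p624348 with the exceptional-zero formula read at EVERY prime, i.e. including the
`p = 2` instance that has no printed proof (GS93: `p ≥ 5`; Kobayashi 2006 Cor. 4.2: odd `p`; x11a-p2 g4's finding, p625569), while LEAD x11a-p1 g1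
registered finemu3 r6 on the sister crux U3 with the ONE stub `stub_nineFactsOddGS` (GS slot `∀ W p, p ≠ 2 → greenberg_stevens`).  U5 reads GS only
at the split multiplicative `p ≥ 5` of the pair, so r7 registers **`FineMu.stub_nineFactsOddGS` — VERBATIM the statement of finemu3 r6's stub** —
in place of `stub_nineFactsAn`, with compositions `UpperNonSurjFive_of_muAnHard_nineFactsOddGS : Theses.PrintX11a.UpperNonSurjFive` (rung
`stub_muAnHardFive` ⊕ `stub_nineFactsOddGS`, through p626443's per-pair theorem `ClassX11a.missingUpperBoundAt_of_not_surj_of_hardCert_of_nineFacts`;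
landed class-wide form `Theorems.upperNonSurjFive_of_muAnHardFive_of_nineFactsOddGS[_glue]`, g7) and `X11aNonSurjEulerHalf_of_muAnHard_nineFactsOddGS :
Theses.PrintX11a.X11aNonSurjEulerHalf` (the PARENT 20406 BY NAME: `p = 3` part = U3's μ₃ THEOREM via `Theorems.upperNonSurjThree_of_nineFacts_oddGS`).
The booking shape asked of the planner (director-bsd 2026-08-28T11:17:57Z (b): child = K2's EXISTING item 19948 `Theorems.NonSurjCornerTwinMuAn`
⟺ the rung mod BDMTV, x11a-p1 g1 p625247; input item = the odd-keyed nine conjuncts SHARED LITERALLY WITH U3; BDMTV) is displayed as the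
CONDITIONAL theorem `UpperNonSurjFive_of_twinMuAn_nineFactsOddGS (hAn : Theorems.NonSurjCornerTwinMuAn)` (glue of record
`Theorems.upperNonSurjFive_of_nonSurjCornerTwinMuAn_of_nineFactsOddGS_glue`, g7).  U3, U5 and their parent are now glued from ONE nine-conjunct
print-exact text plus (for U5 ∕ the parent) ONE open statement.  Registered stubs (7): S1₅ | S1₇ | BDMTV | conjA_five | pubFactsAn (= 19949; the
r1–r5 roads) | nineFactsOddGS | muAnHardFive.  Verdict unchanged (seventh lead): blocked-on stmt-BirchSwinnertonDyer-19948.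

r5 (lead g4, 2026-08-28): r4 UNCHANGED IN EVERY DECLARATION (same six stubs, same compositions); docstrings corrected by g4's finding
`Lines/finemu5-p7-populated-g4.md` (evidence LEAD-g4-FINDINGS.md): the p = 7 regime of U5 is POPULATED, infinitely (Zywina arXiv:1508.07660 Thm 1.5:
image N_s(7) ⟺ j = J₂(t); 7 ∥ N ⟺ v₇(t) < 0, then v₇(Δ_min) = 7·(−v₇(t)) and tameness/Irr/¬Ram are automatic; r_an = 0 infinitely often by twisting,
Friedberg–Hoffstein 1995 Thm B).  Five explicit rank-0 pairs (first known; N = 9 769 208 148, 11 699 528 911, 39 076 832 592; Ш_an = 9, 25, 144, 1, 1), three of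
them on the HARD sub-locus of `Theorems.X11aNonSurjMuAnHardFive` (E₄ = [0,0,0,−1419849332775,−648066076615175202] non-split with ord₇(L(E,1)/Ω) = 1; E₂, E₃ split
at 7).  Hence S1₇ and the p = 7 half of every rung are load-bearing, and no per-pair engine of the cell (modular symbols at level ≥ 9.8·10⁹, 7-descent, Cha at
p ∣ N) can ever book them: at p = 7 the crux is class-wide or nothing.

r4 (lead g3, 2026-08-28): r3 UNCHANGED plus ONE re-registered rung — r1's `stub_muAnHardFive : Theorems.X11aNonSurjMuAnHardFive` (the
μ-road's NATIVE open input: analytic μ(ω⁰) = 0 demanded only on the hard sub-locus of the U5 pairs; per pair it is what the landed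
μ-records certify) — with Composition 4 `UpperNonSurjFive_of_muAnHard` through g0's landed `Theorems.upperNonSurjFive_of_muAnHardFive_via_conjA`
(p609879).  The open inputs of the line now form a registered CHAIN, each rung implying the next modulo the displayed facts:
S1₅ ⊕ S1₇ (⊕ BDMTV) ⟹ `stub_muAnHardFive` (`muAnHardFive_of_multTeich`, r3) ⟹ `stub_conjA_five` (`Theorems.conjAFive_of_muAnHardFive_of_facts`,
p609879) ⟹ the crux (`UpperNonSurjFive_of`).  g3's census (evidence `CENSUS-S1-g3.md`, `Lines/finemu5-S1-census-g3.md`): S1 certified at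
800/800 levels 5M ≤ 4995 and 258/258 levels 7M ≤ 2100 by an independent third implementation; no rung is provable class-wide in print.

r3 (lead g2, after S2 p612440 and S3 p613261 LANDED): S2 and S3 are now theorems BY NAME; S1 is SPLIT PER PRIME exactly as in the
ideator's v4 (critic idea-crit-15 re-probe note 07:05:50Z) — `stub_multTeichSpan_five` | `stub_multTeichSpan_seven` — and the
primes `p ≥ 11` are handled by VACUITY: `le_seven_of_classX11a_nonSurj` (REAL PROOF from the displayed published fact
`stub_splitCartanImagesBDMTV : Theses.ErratumRoadFive.SplitCartanImagesBDMTV` = Balakrishnan–Dogra–Müller–Tuitman–Vonk 2019 Thm. 1.2,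
route ErratumRoadFive aside item BY NAME, via the tree theorem `GaloisImage.eq_five_or_eq_seven_of_mult_of_irr_of_not_surj`).

RESHAPE (L1/L4 of the lead protocol; same composition idea, the ideator lines merged): r1 (lead g0, skeleton bd26e73e) had
three stubs — `stub_conjA_five` ((A)-road, OPEN class-wide), `stub_pubFactsAn` (= K2 item 19949 BY NAME) and the μ-road's RAW
input `stub_muAnHardFive : Theorems.X11aNonSurjMuAnHardFive` (OPEN, no mechanism).  r2 keeps the (A)-road VERBATIM and
DECOMPOSES the μ-road input along ideator bsd-idea-17's published line «multteich5» (`Lines/multteich5.lean`, `Ideas/multteich5.md`),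
whose vocabulary is now the tree module `Theorems/PrintX11aUpperNonSurjFiveMultTeichDefs.lean` (p611571):
* S1 `MultTeich.stub_multTeichSpan` — B⁰ at multiplicative level `pM` (`MultTeichSpanGen M p`: for `γ ∈ Γ₁(pM)`, `γ·γ^ι` lies in
  `⟨packet quotients ∪ finite-order ∪ trace ±2 ∪ p-th powers⟩·[Γ₀,Γ₀]`; PURE GROUP THEORY of `Γ₀(pM)`, finite per level; OPEN;
  ideator census 23/23 levels `pM ≤ 301`, `p ∈ {5,7}`) — THE load-bearing stub of the μ-road;
* S2 `MultTeich.stub_orbitUnit_of_multTeichSpan` — S1 ⟹ a unit Teichmüller orbit sum `A_n(u)` for every `E` with `p ∥ N`,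
  `p ≥ 5`, `E[p]` irreducible (Stevens `ℓ`-bridge with `S = Γ₁(pM)`, Manin's homomorphism read at the cusp `1/p`, `ι`-norm) — LANDED p612440 (lead g2);
* S3 `MultTeich.stub_multMuAn_of_orbitUnit` — a unit orbit sum ⟹ a unit coefficient of `ϖ·L` (Mazur's Manin-constant fact +
  the tree's coset-sum certificate `MuCoset.exists_norm_coeff_eq_one_of_cosetSum_{split,nonsplit}`) — LANDED p613261 (lead g2);
and `muAnHardFive_of_multTeich : Theorems.X11aNonSurjMuAnHardFive` (r1's `stub_muAnHardFive`, now DERIVED from S1–S3 + 19949),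
`UpperNonSurjFive_of_multTeich` (the crux BY NAME from S1–S3 + 19949 through the landed μ-kernel).  Whichever road's stubs land
first closes the crux; after S2/S3 land the crux is closed MODULO {S1, 19949} or {stub_conjA_five, 19949}.

THE TWO LEVERS.  (A)-road: Coates–Sujatha (A) at the pair replaces Kato's image hypothesis at the height-one prime `(p)`
(transfer `Theorems.stub_multDivisibilityAt_of_conjA`, LANDED p606949).  μ-road: one unit coefficient of the Néron-normalised
Mazur–Tate–Teitelbaum function gives (A) and the integral divisibility (`multDivisibilityAt_of_katoFacts_of_muAn`, landed;
road dominance `Theorems.conjAFive_of_muAnHardFive_of_facts`, p609879); S1–S3 manufacture that unit coefficient from ONE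
statement of elementary group theory via Manin's presentation of `H₁(X₀(pM))` and the `ℓ`-Hecke bridge (no `U_p` step: at
`p ∥ N` the one-root measure has `a_p = ±1`, so one unit orbit sum IS `μ(ω⁰) = 0`).

References: [CoatesSujatha2005] §3 (A), Thm. 3.4; [Kato2004Asterisque] Thm. 12.4, 12.5 (3), §17.13 (pp. 279–280); [Wuthrich2014] Cor. 18;
[Manin1972] Prop. 1.4, Thm. 1.9; [MazurTateTeitelbaum1986Invent] §I.10 (10.1), §I.12–I.13; [Mazur1978] Cor. 4.1; [GreenbergLNM1716] Conj. 1.11.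
-/

set_option linter.dupNamespace false
set_option autoImplicit false

noncomputable section

open scoped Classical NumberField MatrixGroups ModularForm

open CongruenceSubgroup WeierstrassCurve Field
  Literature.NumberTheory.EllipticCurves
  Literature.NumberTheory.EllipticCurves.ModularForms
  Literature.NumberTheory.EllipticCurves.Rank1Residual
  Literature.NumberTheory.EllipticCurves.Rank1Residual.Typed
  Literature.NumberTheory.EllipticCurves.Wuthrich2014
  Literature.NumberTheory.EllipticCurves.SteinWuthrich2013
  Literature.NumberTheory.EllipticCurves.Greenberg1999
  Literature.NumberTheory.EllipticCurves.Kato2004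
  Summit.BirchSwinnertonDyer.Rank1Residual
  Summit.BirchSwinnertonDyer.Rank1Residual.X11b
  Summit.BirchSwinnertonDyer.BirchSwinnertonDyer

/-! ### The μ-road, decomposed (ideator bsd-idea-17, «multteich5»): stubs S1–S3 -/

namespace Summit.BirchSwinnertonDyer.BirchSwinnertonDyer.Cruxes.UpperNonSurjFive.MultTeich

/-- **stub S1₅ (THE crux of the μ-road at `p = 5`; OPEN; pure group theory of `Γ₀(5M)`)**: B⁰ at multiplicative level `5M`,
plus side — for every `M` prime to `5` and every `γ ∈ Γ₁(5M)`: `γ·γ^ι ∈ ⟨packet quotients ∪ finite-order ∪ trace ±2 ∪ 5-th powers⟩ ·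
[Γ₀(5M), Γ₀(5M)]` (`MultTeich.MultTeichSpanGen M 5`, tree defs p611571; VERBATIM the ideator's v4 stub).  Census (ideator bsd-idea-17,
exact Manin symbols mod 5, two independent implementations): strong form «packet-quotient classes of levels `n ≤ 3` span
`H₁(X₀(5M);𝔽₅)⁺` modulo Eisenstein» at every level tested (15,20,30,35,40,45,60,65,70; 55,105,110,155,205).  Why it might fail: for
a 5-new irreducible eigenclass it is exactly Greenberg's `μ(ω⁰) = 0`; it also binds 5-old classes (the OPEN good-level B⁰) and mixed /
non-eigen even characters. [cite: Manin1972, Prop. 1.4] [cite: MazurTateTeitelbaum1986Invent, §I.10 (10.1)] [cite: GreenbergLNM1716, Conj. 1.11 (p. 64)] -/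
theorem stub_multTeichSpan_five : ∀ M : ℕ, ¬ 5 ∣ M → MultTeichSpanGen M 5 := by
  sorry

/-- **stub S1₇ (THE crux of the μ-road at `p = 7`; OPEN)**: the same at multiplicative level `7M` (VERBATIM the ideator's v4 stub).
Census: 14,21,28,35,42,63,70; 203,301 (ideator), then 258/258 levels `7M ≤ 2100` (lead g3, `teichspan.cpp`).  LOAD-BEARING (lead g4,
`Lines/finemu5-p7-populated-g4.md`): X11a pairs at `p = 7` EXIST, infinitely many, all with image `N_s(7)` and `N ≥ 9.8·10⁹` in the searched region —
e.g. `[0,0,0,−1419849332775,−648066076615175202]` (`N = 9769208148 = 2²·3⁴·7·131²·251`, `I₇` non-split, `r_an = 0`, `Ш_an = 9`, `ord₇(L/Ω) = 1`: hard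
sub-locus) and the split pairs `[0,0,0,−1419849332775,648066076615175202]`, `[0,0,0,−157761036975,−24002447282043526]` (`N = 39076832592`, `Ш_an = 1`);
none of them is reachable by a per-pair modular-symbol certificate (level `≥ 9.8·10⁹`), so this stub cannot be replaced by records. [cite: Manin1972, Prop. 1.4] [cite: GreenbergLNM1716, Conj. 1.11 (p. 64)] -/
theorem stub_multTeichSpan_seven : ∀ M : ℕ, ¬ 7 ∣ M → MultTeichSpanGen M 7 := by
  sorry

/-- **stub (displayed published input, BY NAME; route `ErratumRoadFive` aside item `SplitCartanImagesBDMTV`)**: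
Balakrishnan–Dogra–Müller–Tuitman–Vonk 2019 Thm. 1.2 «only if» (with Bilu–Parent–Rebolledo 2013 Cor. 1.2 inside): no non-CM `E/ℚ`
has mod-`p` image in the normaliser of a split Cartan for `p > 7` (tree named fact
`BalakrishnanEtAl2019.thm12_not_le_normalizer_splitCartan`, size XL, no `_holds`).  It is NOT a conjunct of 19949, hence its own
stub; it feeds only the vacuity lemma `le_seven_of_classX11a_nonSurj`. [cite: BalakrishnanEtAl2019, §1 Thm. 1.2 (arXiv:1711.05846 p. 2)] -/
theorem stub_splitCartanImagesBDMTV : Theses.ErratumRoadFive.SplitCartanImagesBDMTV := by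
  sorry

/-- **VACUITY beyond `p = 7` (real proof; the ideator's v4 stub `stub_le_seven_of_classX11a_nonSurj` DISCHARGED modulo BDMTV)**: an
X11a pair with `ρ̄_{E,p}` not surjective has `p ≤ 7` — at a multiplicative `p ≥ 5`, `Irr ∧ ¬Surj` forces `p ∈ {5, 7}` by the tree
theorem `GaloisImage.eq_five_or_eq_seven_of_mult_of_irr_of_not_surj` (Tate inertia gives a split torus of order `p − 1` in the
image; exceptional and non-split-Cartan images are excluded by Dickson; split-Cartan normalisers by BDMTV); `p < 5` is trivial.
[cite: BalakrishnanEtAl2019, §1 Thm. 1.2 (arXiv:1711.05846 p. 2)] [cite: Serre1972, §2.4–2.6] -/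
theorem le_seven_of_classX11a_nonSurj (W : WeierstrassCurve ℚ) [W.IsElliptic] [W.IsGloballyMinimal] (p : ℕ) [Fact p.Prime]
    (hX : ClassX11a W p) (hns : ¬ Surj W p) : p ≤ 7 := by
  by_cases h5 : 5 ≤ p
  · rcases GaloisImage.eq_five_or_eq_seven_of_mult_of_irr_of_not_surj W p stub_splitCartanImagesBDMTV h5 hX.2.2.1
      hX.2.2.2.1 hns with h | h <;> omega
  · omega

/-- **Dispatch (real proof)**: on the U5 domain the span hypothesis needed by S2 at the prime `p` of the pair is S1₅ or S1₇
(`le_seven_of_classX11a_nonSurj` + `interval_cases`; `p = 6` is not prime). [cite: Manin1972, Prop. 1.4] -/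
theorem multTeichSpan_of_classX11a_nonSurj (W : WeierstrassCurve ℚ) [W.IsElliptic] [W.IsGloballyMinimal] (p : ℕ) [Fact p.Prime]
    (hX : ClassX11a W p) (hns : ¬ Surj W p) (hp5 : 5 ≤ p) : ∀ M : ℕ, ¬ p ∣ M → MultTeichSpanGen M p := by
  have hp : p.Prime := Fact.out
  have h7 : p ≤ 7 := le_seven_of_classX11a_nonSurj W p hX hns
  intro M hM
  interval_cases p
  · exact stub_multTeichSpan_five M hM
  · exact absurd hp (by decide)
  · exact stub_multTeichSpan_seven M hM

/-- **S2, LANDED (lead g2, p612440 `Theorems/PrintX11aUpperNonSurjFiveOrbitUnitOfMultTeichSpan.lean`) — pointwise form used here**: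
at the odd prime `p` of the pair, B⁰ at the levels `pM` ⟹ a unit Teichmüller orbit sum for every newform (level form
`exists_one_le_norm_teichOrbitSum_of_multTeichSpanGen`; the non-Eisenstein prime `ℓ` from irreducibility). No `sorry`.
[cite: Manin1972, Prop. 1.4 and Thm. 1.9] [cite: MazurTateTeitelbaum1986Invent, §I.10 (10.1)] -/
theorem orbitUnit_of_multTeichSpan_at (W : WeierstrassCurve ℚ) [W.IsElliptic] [W.IsGloballyMinimal] (p : ℕ) [Fact p.Prime]
    (hp2 : p ≠ 2) (hS1 : ∀ M : ℕ, ¬ p ∣ M → MultTeichSpanGen M p) (hmult : Mult W p) (hirr : Irr W p) :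
    MultTeichOrbitUnitAt W p := by
  intro N _ f hf
  obtain ⟨⟨M, hM⟩, hsq, -⟩ := hf.dvd_level_and_not_sq_dvd_of_multiplicative hmult
  subst hM
  have hpM : ¬ p ∣ M := by
    rintro ⟨k, rfl⟩
    exact hsq ⟨k, by ring⟩
  obtain ⟨ℓ, _, -, hgoodℓ, hℓ1⟩ :=
    exists_prime_not_dvd_frobeniusTrace_sub not_irreducible_of_frobeniusTrace_congr_holds W p hirr
  have hℓN : ¬ ℓ ∣ p * M := not_dvd_level_of_isNewformOf hf hgoodℓ
  exact exists_one_le_norm_teichOrbitSum_of_multTeichSpanGen hf.1 hf.coeffField_eq_bot hp2 hℓN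
    (cuspCoeff_eq_frobeniusTrace_of_isNewformOf_holds hf hgoodℓ) hℓ1 (hS1 M hpM)

end Summit.BirchSwinnertonDyer.BirchSwinnertonDyer.Cruxes.UpperNonSurjFive.MultTeich

/-! ### The (A)-road (VERBATIM r1) and the shared published inputs -/

namespace Summit.BirchSwinnertonDyer.BirchSwinnertonDyer.Cruxes.UpperNonSurjFive.FineMu

/-- **stub (load-bearing for the (A)-road, OPEN class-wide; VERBATIM r1)**: Coates–Sujatha's statement (A) — `X₀(E/ℚ_∞)` finitely
generated over `ℤ_p` (tree carrier `Rank1Residual.ConjAAt`) — at every X11a pair with `p ≥ 5` and `ρ̄_{E,p}` not surjective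
(`p ∥ N`; by [BDMTV] `p ∈ {5, 7}`, image `5Ns`/`5S4`/`7Ns`). Per pair a first-layer class-group certificate on `ℚ(E[p])`; class-wide an
instance of Iwasawa's `μ = 0` conjecture for these fields (`CoatesSujatha2005.thm34_…` in the tree); OPEN.
[cite: CoatesSujatha2005, §3 statement (A) and Thm. 3.4] [cite: DeoRaySujatha2023, Thm. 3.9 (b) and Lemma 5.1] -/
theorem stub_conjA_five :
    ∀ (W : WeierstrassCurve ℚ) [W.IsElliptic] [W.IsGloballyMinimal] (p : ℕ) [Fact p.Prime],
      ClassX11a W p → ¬ Surj W p → 5 ≤ p → ConjAAt W p := by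
  sorry

/-- **stub 2 of r1 — LANDED (the TRANSFER, `p`-generic, proved modulo the displayed named facts; x11a-p2 p606949)**: at an ODD prime of
MULTIPLICATIVE reduction with `E[p]` irreducible, statement (A) at the pair gives the INTEGRAL cyclotomic divisibility
`X11b.MultDivisibilityAt`. Kept BY NAME as a no-sorry wrapper. [cite: Kato2004Asterisque, Thm. 12.5 (3) (p. 222), §17.13 (pp. 279–280)]
[cite: Wuthrich2014, Cor. 18 (p. 398)] -/
theorem stub_multDivisibilityAt_of_conjA :
    Kato2004.nonempty_iwasawaH1Data → Kato2004.thm12_4 →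
    Kato2004.exists_multDivisibilityInputs_nonsplit → Kato2004.exists_multDivisibilityInputs_split →
    thm15_isTorsion_multiplicative_rat →
    Wuthrich2014.corollary18_padicLFunction_mem_iwasawaAlgebra_multiplicative →
    Kato2004.exists_multDivisibilityInputs_fine →
    ∀ (W : WeierstrassCurve ℚ) [W.IsElliptic] [W.IsGloballyMinimal] (p : ℕ) [Fact p.Prime],
      p ≠ 2 → Mult W p → Irr W p → ConjAAt W p → MultDivisibilityAt W p :=
  Theorems.stub_multDivisibilityAt_of_conjA

/-- **stub (published inputs, shared by both roads; VERBATIM r1)**: K2's item 19949 BY NAME — the conjunction of the named published facts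
(GZK, modularity, parametrisation, Stein–Wuthrich 6.1 split/non-split, Mazur's Manin constant, Greenberg–Stevens, Kato 12.4 and the
multiplicative §17.13 inputs, Greenberg 1999 Thm. 1.5, Wuthrich 2014 Cor. 18, Kato fine inputs, …).
[cite: Kato2004Asterisque, Thm. 12.4 (p. 221)] [cite: SteinWuthrich2013, Thm. 6.1 (p. 20)] -/
theorem stub_pubFactsAn : Theses.ErratumRoadFive.KatoTwinFactsFiveAn := by
  sorry

/-- **Composition 1 — the (A)-road (real proof, VERBATIM r1)**: `stub_conjA_five` ⟹ (`stub_multDivisibilityAt_of_conjA`, fed the named facts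
unpacked from `stub_pubFactsAn`) `MultDivisibilityAt` ⟹ (door `X11b.missingUpperBoundAt_of_classX11a_of_multDivisibilityAt`) the crux BY NAME.
[cite: Kato2004Asterisque, §17.13 (pp. 279–280)] [cite: SteinWuthrich2013, Thm. 6.1 (p. 20)] -/
theorem UpperNonSurjFive_of : Theses.PrintX11a.UpperNonSurjFive := by
  obtain ⟨-, -, -, hGZK, hmod, -, hpar, -, -, -, -, hJs, hJn, hGS, -, -, hne, h12, hnsI, hspI, h15, h18,
    hfine⟩ := stub_pubFactsAn
  intro W _ _ p _ hX hns hp5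
  exact missingUpperBoundAt_of_classX11a_of_multDivisibilityAt hJs hJn hGZK hmod hpar W p (hGS W p) hX
    (stub_multDivisibilityAt_of_conjA hne h12 hnsI hspI h15 h18 hfine W p hX.2.1 hX.2.2.1 hX.2.2.2.1
      (stub_conjA_five W p hX hns hp5))

end Summit.BirchSwinnertonDyer.BirchSwinnertonDyer.Cruxes.UpperNonSurjFive.FineMu

/-! ### Compositions of the μ-road (real proofs, stubs applied BY NAME) -/

namespace Summit.BirchSwinnertonDyer.BirchSwinnertonDyer.Cruxes.UpperNonSurjFive.MultTeich

/-- **r1's registered `stub_muAnHardFive` is now DERIVED**: S1–S3 + 19949 ⟹ `Theorems.X11aNonSurjMuAnHardFive` (the hard-locus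
disjunction and `¬ Surj` are not used).  [cite: GreenbergLNM1716, Conj. 1.11 (p. 62)] [cite: MazurTateTeitelbaum1986Invent, §I.10–I.13] -/
theorem muAnHardFive_of_multTeich : Theorems.X11aNonSurjMuAnHardFive := by
  obtain ⟨-, -, -, -, -, -, -, -, hM, -, -, -, -, -, -, -, -, -, -, -, -, h18, -⟩ := FineMu.stub_pubFactsAn
  intro W _ _ p _ hX _hns hp5 _hhard N _ f hf ϖ hϖ a L ha1 ha2 hL
  exact stub_multMuAn_of_orbitUnit hM h18 W p hp5 hX.2.2.1 hX.2.2.2.1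
    (orbitUnit_of_multTeichSpan_at W p hX.2.1 (multTeichSpan_of_classX11a_nonSurj W p hX _hns hp5) hX.2.2.1 hX.2.2.2.1)
    f hf ϖ hϖ a L ha1 ha2 hL

/-- **Composition 2 — the μ-road through S1–S3 (real proof), concluding the crux BY NAME**: at every X11a pair with `ρ̄_{E,p}` not
surjective and `p ≥ 5`, S1–S3 give `MultMuAnAt W p`, the landed μ-kernel `multDivisibilityAt_of_katoFacts_of_muAn` gives
`MultDivisibilityAt W p`, and the landed door `missingUpperBoundAt_of_classX11a_of_multDivisibilityAt` gives `MissingUpperBoundAt W p`.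
[cite: Kato2004Asterisque, §17.13 (pp. 279–280)] [cite: SteinWuthrich2013, Thm. 6.1 (p. 20)] -/
theorem UpperNonSurjFive_of_multTeich : Theses.PrintX11a.UpperNonSurjFive := by
  obtain ⟨-, -, -, hGZK, hmod, -, hpar, -, hM, -, -, hJs, hJn, hGS, -, -, hne, h12, hnsI, hspI, h15, h18,
    hfine⟩ := FineMu.stub_pubFactsAn
  intro W _ _ p _ hX hns hp5
  have hμ : MultMuAnAt W p :=
    stub_multMuAn_of_orbitUnit hM h18 W p hp5 hX.2.2.1 hX.2.2.2.1
      (orbitUnit_of_multTeichSpan_at W p hX.2.1 (multTeichSpan_of_classX11a_nonSurj W p hX hns hp5) hX.2.2.1 hX.2.2.2.1)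
  exact missingUpperBoundAt_of_classX11a_of_multDivisibilityAt hJs hJn hGZK hmod hpar W p (hGS W p) hX
    (multDivisibilityAt_of_katoFacts_of_muAn hne h12 hnsI hspI h15 h18 hfine W p hX.2.1 hX.2.2.1 hX.2.2.2.1 hns
      (fun f hf => hμ f hf))

/-- **Composition 3 — the orbit-unit FALLBACK (real proof, no span statement)**: ANY road supplying a unit Teichmüller orbit sum at
every U5 pair (`MultTeichOrbitUnitAt W p` — per pair a finite modular-symbol certificate) closes the crux through the landed S3, the
μ-kernel and the door.  (The ideator's v4 `UpperNonSurjFive_of_orbitUnit`.) [cite: MazurTateTeitelbaum1986Invent, §I.10–I.13]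
[cite: Kato2004Asterisque, §17.13 (pp. 279–280)] -/
theorem UpperNonSurjFive_of_orbitUnit
    (h : ∀ (W : WeierstrassCurve ℚ) [W.IsElliptic] [W.IsGloballyMinimal] (p : ℕ) [Fact p.Prime],
      ClassX11a W p → ¬ Surj W p → 5 ≤ p → MultTeichOrbitUnitAt W p) :
    Theses.PrintX11a.UpperNonSurjFive := by
  obtain ⟨-, -, -, hGZK, hmod, -, hpar, -, hM, -, -, hJs, hJn, hGS, -, -, hne, h12, hnsI, hspI, h15, h18,
    hfine⟩ := FineMu.stub_pubFactsAn
  intro W _ _ p _ hX hns hp5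
  have hμ : MultMuAnAt W p :=
    stub_multMuAn_of_orbitUnit hM h18 W p hp5 hX.2.2.1 hX.2.2.2.1 (h W p hX hns hp5)
  exact missingUpperBoundAt_of_classX11a_of_multDivisibilityAt hJs hJn hGZK hmod hpar W p (hGS W p) hX
    (multDivisibilityAt_of_katoFacts_of_muAn hne h12 hnsI hspI h15 h18 hfine W p hX.2.1 hX.2.2.1 hX.2.2.2.1 hns
      (fun f hf => hμ f hf))

/-- **stub (r4, lead g3: r1's μ-road input RE-REGISTERED as the middle rung; OPEN class-wide = Greenberg's analytic `μ(ω⁰) = 0` on the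
hard sub-locus of the U5 pairs; per pair = the landed μ-records)**: the tree's `@[conjecture]` constant `Theorems.X11aNonSurjMuAnHardFive`
(`Theorems/PrintX11aNonSurjMuAnHardDefs.lean`): at every X11a pair with `ρ̄_{E,p}` not surjective, `p ≥ 5`, that is split at `p` or has
`ord_p(L(E,1)/Ω_E) ≠ 0`, SOME coefficient of the Néron-normalised Mazur–Tate–Teitelbaum function `ϖ·L` (allowable root `a = ±1`) is a
`p`-adic unit.  DERIVED from S1₅ ⊕ S1₇ (⊕ BDMTV ⊕ 19949) by `muAnHardFive_of_multTeich` above; IMPLIES `FineMu.stub_conjA_five`'s statement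
by `Theorems.conjAFive_of_muAnHardFive_of_facts` (p609879).  Registered so that the weakest native μ-statement of the line is an explicit rung.
[cite: GreenbergLNM1716, Conj. 1.11 (p. 62) (shape only)] [cite: MazurTateTeitelbaum1986Invent, §I.10–I.13] -/
theorem stub_muAnHardFive : Theorems.X11aNonSurjMuAnHardFive := by
  sorry

/-- **Composition 4 — the μ-road from its NATIVE input (real proof)**: `stub_muAnHardFive` ⊕ `stub_pubFactsAn` ⟹ the crux BY NAME, through
g0's landed `Theorems.upperNonSurjFive_of_muAnHardFive_via_conjA` (unit coefficient ⟹ Sel₀[p] finite ⟹ (A) ⟹ Kato transfer at the height-one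
prime `(p)` ⟹ `MultDivisibilityAt` ⟹ door; the complement of the hard sub-locus closes inside that theorem by the unit-value door).
[cite: CoatesSujatha2005, §3 statement (A), Thm. 3.4] [cite: Kato2004Asterisque, §17.13 (pp. 279–280)] -/
theorem UpperNonSurjFive_of_muAnHard : Theses.PrintX11a.UpperNonSurjFive :=
  Theorems.upperNonSurjFive_of_muAnHardFive_via_conjA stub_muAnHardFive FineMu.stub_pubFactsAn

end Summit.BirchSwinnertonDyer.BirchSwinnertonDyer.Cruxes.UpperNonSurjFive.MultTeich

/-! ### r7 (lead g7): the print-exact nine-fact input, Greenberg–Stevens keyed at ODD primes (shared VERBATIM with finemu3 r6), and its compositions -/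

namespace Summit.BirchSwinnertonDyer.BirchSwinnertonDyer.Cruxes.UpperNonSurjFive.FineMu

/-- **stub (r7; published inputs — the MINIMAL print-exact bundle, VERBATIM the statement of finemu3 r6's `stub_nineFactsOddGS` on the sister
crux U3)**: the conjunction of the NINE statement-only named facts of `Theorems.upperNonSurjFive_of_muAnHardFive_of_nineFactsOddGS` (g7) ∕
`Theorems.upperNonSurjThree_of_nineFacts_oddGS` (x11a-p2 g4) — Stein–Wuthrich 2013 Thm. 6.1 (split, non-split), Greenberg–Stevens ∕ Kobayashi at
every ODD prime (Kobayashi 2006 Cor. 4.2 VERBATIM scope; g6's r6 slot `stub_nineFactsAn` read it at every prime incl. the unprinted `p = 2`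
instance), Kato 2004 Thm. 12.4, modularity, Kato §17.13 construction facts V′ ∕ VI′ ∕ XI′ (`_contra`, print-exact), Mazur 1978 Cor. 4.1.  Named
Literature facts, never «proved»; = the planner's ONE input item shared by U3 and U5.
[cite: SteinWuthrich2013, Thm. 6.1 (p. 20)] [cite: Kato2004Asterisque, Thm. 12.4 (p. 221) and §17.13 (pp. 279–280)] [cite: Mazur1978, Cor. 4.1]
[cite: Kobayashi2006DocMath, Cor. 4.2 (p. 575)] -/
theorem stub_nineFactsOddGS :
    thm61_splitMultiplicative ∧ thm61_nonsplitMultiplicative ∧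
      (∀ (W : WeierstrassCurve ℚ) [W.IsElliptic] [W.IsGloballyMinimal] (p : ℕ) [Fact p.Prime],
        p ≠ 2 → greenberg_stevens (W := W) (p := p)) ∧
      Kato2004.thm12_4 ∧ exists_isNewformOf ∧
      Kato2004.exists_multDivisibilityInputs_nonsplit_contra ∧
      Kato2004.exists_multDivisibilityInputs_split_contra ∧
      Kato2004.exists_multDivisibilityInputs_fine_contra ∧ mazur_not_dvd_maninConstant_of_odd := by
  sorry

/-- **Composition 5 (r7, real proof) — THE booking shape, option (a)**: the rung `MultTeich.stub_muAnHardFive` ⊕ `stub_nineFactsOddGS` ⟹ the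
crux BY NAME.  Per pair this is p626443's `ClassX11a.missingUpperBoundAt_of_not_surj_of_hardCert_of_nineFacts` (the easy locus — `p` non-split
with a unit special value — folded in by the constant-coefficient certificate; GS read only at a split `p`, `p ≠ 2` from the class); class-wide it
is g7's landed `Theorems.upperNonSurjFive_of_muAnHardFive_of_nineFactsOddGS` (inlined here so that the skeleton elaborates on today's tree).  No
GZK, no Cor-18 fact, no Greenberg 1.5, no (A), no 19949. [cite: GreenbergLNM1716, §1 Conj. 1.11 (p. 62)] [cite: Kobayashi2006DocMath, Cor. 4.2 (p. 575)]
[cite: Kato2004Asterisque, Thm. 12.4 (p. 221) and §17.13 (pp. 279–280)] [cite: SteinWuthrich2013, Thm. 6.1 (p. 20)] [cite: Mazur1978, Cor. 4.1] -/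
theorem UpperNonSurjFive_of_muAnHard_nineFactsOddGS : Theses.PrintX11a.UpperNonSurjFive := by
  obtain ⟨hJs, hJn, hGS, h12, hnf, hns', hsp', hfine', hMz⟩ := stub_nineFactsOddGS
  intro W _ _ p _ hX hns hp5
  exact Rank1Residual.ClassX11a.missingUpperBoundAt_of_not_surj_of_hardCert_of_nineFacts hJs hJn h12 hnf hns' hsp'
    hfine' hMz W p (fun _ => hGS W p hX.ne_two) hX hns (fun hhard _ _ f hf ϖ hϖ a L hsa hna hL =>
      MultTeich.stub_muAnHardFive W p hX hns hp5 hhard f hf ϖ hϖ a L hsa hna hL)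

/-- **Composition 6 (r7, real proof) — the PARENT crux `X11aNonSurjEulerHalf` (item 20406) BY NAME from the rung and the odd-keyed nine facts**:
the `p = 3` part is U3's μ₃ THEOREM (`Theorems.upperNonSurjThree_of_nineFacts_oddGS`, x11a-p2 g4: GS read at a split `3`), the `p ≥ 5` part is
Composition 5; an X11a pair has `p ≠ 2`, so `p = 3 ∨ 5 ≤ p`.  So the whole Euler-system half of route `PrintX11a` at non-surjective image holds in
the kernel MODULO {`stub_muAnHardFive` (⟺ item 19948 mod BDMTV), `stub_nineFactsOddGS`}. [cite: GreenbergLNM1716, §1 Conj. 1.11 (p. 62)]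
[cite: Kobayashi2006DocMath, Cor. 4.2 (p. 575)] [cite: Kato2004Asterisque, §17.13 (pp. 279–280)] [cite: Mazur1978, Cor. 4.1] -/
theorem X11aNonSurjEulerHalf_of_muAnHard_nineFactsOddGS : Theses.PrintX11a.X11aNonSurjEulerHalf := by
  obtain ⟨hJs, hJn, hGS, h12, hnf, hns', hsp', hfine', hMz⟩ := stub_nineFactsOddGS
  intro W _ _ p _ hX hns
  by_cases h3 : p = 3
  · exact Theorems.upperNonSurjThree_of_nineFacts_oddGS hJs hJn hGS h12 hnf hns' hsp' hfine' hMz W p hX hns h3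
  · have hpP : p.Prime := Fact.out
    have h2 : p ≠ 2 := hX.ne_two
    have h2le := hpP.two_le
    have h4 : p ≠ 4 := fun h => by rw [h] at hpP; exact absurd hpP (by decide)
    exact UpperNonSurjFive_of_muAnHard_nineFactsOddGS W p hX hns (by omega)

/-- **The booking shape, option (b) (director-bsd 2026-08-28T11:17:57Z), displayed as a CONDITIONAL theorem**: K2's EXISTING item 19948
`Theorems.NonSurjCornerTwinMuAn` (hypothesis `hAn`; ⟺ the rung mod BDMTV, x11a-p1 g1 p625247) ⊕ `MultTeich.stub_splitCartanImagesBDMTV` ⊕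
`stub_nineFactsOddGS` ⟹ the crux BY NAME — glue of record `Theorems.upperNonSurjFive_of_nonSurjCornerTwinMuAn_of_nineFactsOddGS_glue` (g7; inlined
through `Theorems.x11aNonSurjMuAnHardFive_of_nonSurjCornerTwinMuAn` + Composition 5's per-pair theorem so that it elaborates on today's tree).
Not a registered stub road (19948 is an ITEM, staffed under route `ErratumRoadFive`); sorry-free given `hAn`.
[cite: BalakrishnanEtAl2019, §1 Thm. 1.2 (arXiv:1711.05846 p. 2)] [cite: GreenbergLNM1716, §1 Conj. 1.11 (p. 62)] [cite: Kobayashi2006DocMath, Cor. 4.2 (p. 575)] -/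
theorem UpperNonSurjFive_of_twinMuAn_nineFactsOddGS (hAn : Theorems.NonSurjCornerTwinMuAn) : Theses.PrintX11a.UpperNonSurjFive := by
  obtain ⟨hJs, hJn, hGS, h12, hnf, hns', hsp', hfine', hMz⟩ := stub_nineFactsOddGS
  have hH : Theorems.X11aNonSurjMuAnHardFive :=
    Theorems.x11aNonSurjMuAnHardFive_of_nonSurjCornerTwinMuAn MultTeich.stub_splitCartanImagesBDMTV hAn
  intro W _ _ p _ hX hns hp5
  exact Rank1Residual.ClassX11a.missingUpperBoundAt_of_not_surj_of_hardCert_of_nineFacts hJs hJn h12 hnf hns' hsp'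
    hfine' hMz W p (fun _ => hGS W p hX.ne_two) hX hns (fun hhard _ _ f hf ϖ hϖ a L hsa hna hL =>
      hH W p hX hns hp5 hhard f hf ϖ hϖ a L hsa hna hL)

end Summit.BirchSwinnertonDyer.BirchSwinnertonDyer.Cruxes.UpperNonSurjFive.FineMu

end
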